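import Summits.CriticalPhenomena.PercolationContinuityZ3.Theorems.PercNearOneGluingNoHeavyQuantGatedSliceMixLawQRouting
import Summits.CriticalPhenomena.PercolationContinuityZ3.Theorems.PercNearOneGluingNoHeavyQuantLawDecUsageMonge
import Summits.CriticalPhenomena.PercolationContinuityZ3.Theorems.PercNearOneGluingNoHeavyQuantFlowPieces
import HarnessLib

/-!
# QUANT lane R8, T-DEC, leg (III), blob case — `LawDec.GatedSliceMixLaw'`, Q-ALONE side: cell QH (`2S < t`) with the top `k₂` a GIANT
# (classes `LmGG`, `LMGG`), part 1: the routing step with pooled giants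

builds on p205010 (kernel theorem, internal audit signed; external expert review pending)

Support file (`--supports stmt-CriticalPhenomena-4575`), QUANT lane seat prim-quant-arm-1 (gen 41), rung R8 of `run/shared/lean/prim/quant/LADDER.md`.
Theorems only, standard axioms, no sorries, no definitions.  Uses `…QRouting` (`mixLawQ_decAtT_of_routing`: lows `{0,k₁}`, absorbers the twin
`P = k₁ + a`, the top `K = k₂` — here a giant — and `G = k₂ + a`).  ROUTING (`u = y/(1−y)`): the low `k₁` fills the twin first; the overflow and the
zero ride the two giants (pooled capacity `C + D`, split proportionally).  CERTIFICATES (exact census `work/explore/qQK.py`, class `KGH`: 22 093 / 0;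
without `2S < t` the class has genuine mixtures — 165 non-DEC in 42 175 — so the blob hypothesis is load-bearing):
* twin CLOSED to `k₁` (`2k₁ + a ≤ t`): `y(z + A) ≤ (1−y)(C + D)`, affine in `y`, at `y = S/k₂` it is `m(1−λ)(Sg − k₁) ≥ 0` (`S ≥ 2k₁`, `g > 1/2`);
* twin open and `k₁` fits: the zero fits the leftovers termwise (mean identity, `usage_mid_mul_le`, `y·k₂ ≤ S ≤ t`);
* twin open and `k₁` saturates it (`cap = B/usage(k₁,P)`): `y(z + A − cap) ≤ (1−y)(C + D)` — heavy pair: `(y − C − D)(t − 2k₁) ≤ yBa`, affine in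
  `y`, at `y = S/k₂` it is `m(1−λ)(S·g·a − k₁(t − 2k₁)) ≥ 0` (case `ga ≥ k₁`: `S ≥ m(k₁ + λ(a+1))`; case `ga < k₁`: `S ≤ agm`); light pair:
  `y − C − D ≤ B`, `γ ≤ y`.
* this file (part 1): `qh_pool_cap`, `qh_twin_term` (pure real) and **`mixLawQ_decAtT_qh_route`** (the routing step: `xP` of `k₁` into the
  twin, `w` to the pooled giants, from the twin capacity, `y·w ≤ (1−y)(C+D)` and the offer inequality); and `mixLawQ_decAtT_qh_giantTop_closed` (twin closed to `k₁`);
  part 2 (`…QHGiantTop`): `mixLawQ_decAtT_qh_giantTop_open`, `mixLawQ_decAtT_qh_giantTop`.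
HONEST STATUS: cells QK/QH/Q4 assemblies pending; `GatedSliceMixLaw'` (regime R), CW, `GateMove`, `GatedConvEmptyFree`, `SingleGateConvClosed`,
`TreeDEC`, `FarTreeRow` OPEN; RATE class log\* / honest sentence unchanged.

[this work]; node: prim-quant-stmt g29/g30 (this lane).  Nothing here is cited as a published result.  The gluing rows served
[cite: KozmaNitzan2024, Conjecture 3 (p. 15)]; product measure [cite: Grimmett1999, §1.3 p. 10].
-/

noncomputable section

namespace Summit.CriticalPhenomena.PercolationContinuityZ3.Theorems

namespace Quant

open Finset

/-- the two-point law `{lo, hi; g}` (as in `…QuantLawDEC`) -/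
local notation3 "TP[" lo ", " hi ", " g ", " h "]" =>
  (g : ℝ) * (if (h : ℕ) = (hi : ℕ) then (1 : ℝ) else 0) + (1 - (g : ℝ)) * (if (h : ℕ) = (lo : ℕ) then (1 : ℝ) else 0)

namespace LawDec

/-- pooled giants: with `C + D > 0` and `y·w ≤ (1−y)(C + D)`, the proportional split `w·C/(C+D)`, `w·D/(C+D)` respects each capacity. -/
theorem qh_pool_cap (y w C D : ℝ) (hy1 : y < 1) (hC0 : 0 ≤ C) (hD0 : 0 ≤ D) (hCD : 0 < C + D)
    (hw : y * w ≤ (1 - y) * (C + D)) :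
    y / (1 - y) * (w * C / (C + D)) ≤ C ∧ y / (1 - y) * (w * D / (C + D)) ≤ D := by
  have h1y : 0 < 1 - y := by linarith
  have hu : y / (1 - y) * w ≤ C + D := by
    rw [div_mul_eq_mul_div, div_le_iff₀ h1y]; linarith
  have hCD' : (C + D) ≠ 0 := ne_of_gt hCD
  constructor
  · have e : y / (1 - y) * (w * C / (C + D)) = (y / (1 - y) * w) * (C / (C + D)) := by ring
    rw [e]
    calc (y / (1 - y) * w) * (C / (C + D)) ≤ (C + D) * (C / (C + D)) :=
          mul_le_mul_of_nonneg_right hu (div_nonneg hC0 hCD.le)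
      _ = C := by field_simp
  · have e : y / (1 - y) * (w * D / (C + D)) = (y / (1 - y) * w) * (D / (C + D)) := by ring
    rw [e]
    calc (y / (1 - y) * w) * (D / (C + D)) ≤ (C + D) * (D / (C + D)) :=
          mul_le_mul_of_nonneg_right hu (div_nonneg hD0 hCD.le)
      _ = D := by field_simp

/-- the twin's term of the zero's offer when `xP ≤ A` of `k₁` is shipped into it: with `usage(k₁,P)·(P − t) ≤ t − k₁`,
`−(t−k₁)A − (t−P)B ≤ κ(P)(B − usage·A)`. -/
theorem qh_twin_term (t k₁ a P U A B : ℝ) (hP : P = k₁ + a) (hU : t < P → U * (P - t) ≤ t - k₁)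
    (hA0 : 0 ≤ A) (hB0 : 0 ≤ B) (hk : k₁ ≤ t) :
    -((t - k₁) * A) - (t - (k₁ + a)) * B ≤ (if t < P then P - t else 0) * (B - U * A) := by
  by_cases htP : t < P
  · rw [if_pos htP]
    have h2 : U * (P - t) * A ≤ (t - k₁) * A := mul_le_mul_of_nonneg_right (hU htP) hA0
    have key : (P - t) * (B - U * A) - (-((t - k₁) * A) - (t - (k₁ + a)) * B)
        = ((t - k₁) * A - U * (P - t) * A) + (P - (k₁ + a)) * B := by ring
    rw [hP] at key ⊢
    rw [sub_self, zero_mul, add_zero] at key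
    rw [← hP] at key ⊢
    linarith [key, h2]
  · rw [if_neg htP, zero_mul]
    have htP' : k₁ + a ≤ t := by rw [← hP]; exact not_lt.1 htP
    have e1 : 0 ≤ (t - k₁) * A := mul_nonneg (by linarith) hA0
    have e2 : 0 ≤ (t - (k₁ + a)) * B := mul_nonneg (by linarith) hB0
    linarith

set_option maxHeartbeats 800000 in
/-- the common routing step of cell QH with a giant top: `xP` of `k₁` into the twin, `w` to the pooled giants. -/
theorem mixLawQ_decAtT_qh_route (y z g S lam : ℝ) (a j M k₁ k₂ : ℕ)
    (hy0 : 0 < y) (hy1 : y < 1) (hz0 : 0 ≤ z) (hz1 : z < 1) (hg1 : g ≤ 1) (hyg : y ≤ (1 - z) * g) (ha : 1 ≤ a)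
    (hta : y * (M : ℝ) ≤ S) (hk : k₁ ≤ k₂) (hk₂M : k₂ ≤ M) (hlam0 : 0 ≤ lam) (hlam1 : lam ≤ 1)
    (hmean : (1 - z) * ((k₁ : ℝ) + ((k₂ : ℝ) - k₁) * lam) = S)
    (hk₁ : 1 ≤ k₁) (hk₁j : k₁ ≤ j) (hk₁low : 2 * (k₁ : ℝ) < S + (a : ℝ) * g * (1 - z))
    (hPj : k₁ + a ≤ j) (hPmid : S + (a : ℝ) * g * (1 - z) ≤ 2 * ((k₁ + a : ℕ) : ℝ))
    (hKG : j + 1 ≤ k₂) (xP w : ℝ) (hxP0 : 0 ≤ xP) (hw0 : 0 ≤ w)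
    (hsplit : xP + w = (1 - z) * (1 - lam) * (1 - g))
    (hPcomp : 0 < xP → S + (a : ℝ) * g * (1 - z) < (k₁ : ℝ) + ((k₁ + a : ℕ) : ℝ))
    (hcapP : usage y (S + (a : ℝ) * g * (1 - z)) j k₁ (k₁ + a) * xP ≤ (1 - z) * (1 - lam) * g)
    (hwcap : y * w ≤ (1 - y) * ((1 - z) * lam * (1 - g) + (1 - z) * lam * g))
    (hoff : (S + (a : ℝ) * g * (1 - z)) * z ≤
      (if S + (a : ℝ) * g * (1 - z) < ((k₁ + a : ℕ) : ℝ) then ((k₁ + a : ℕ) : ℝ) - (S + (a : ℝ) * g * (1 - z)) else 0)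
        * ((1 - z) * (1 - lam) * g - usage y (S + (a : ℝ) * g * (1 - z)) j k₁ (k₁ + a) * xP)
      + (S + (a : ℝ) * g * (1 - z)) * (1 - y) / y * ((1 - z) * lam * (1 - g) + (1 - z) * lam * g)
      - (S + (a : ℝ) * g * (1 - z)) * w) :
    DECAtT y (S + (a : ℝ) * g * (1 - z)) j (M + a)
      (fun p => z * (if p = 0 then (1 : ℝ) else 0) + (1 - z) * slice (fun q => TP[k₁, k₂, lam, q]) a g p) := by
  set t : ℝ := S + (a : ℝ) * g * (1 - z) with ht
  set A : ℝ := (1 - z) * (1 - lam) * (1 - g) with hA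
  set B : ℝ := (1 - z) * (1 - lam) * g with hB
  set C : ℝ := (1 - z) * lam * (1 - g) with hC
  set D : ℝ := (1 - z) * lam * g with hD
  have hg0 : 0 < g := by
    by_contra hc
    have : (1 - z) * g ≤ 0 := mul_nonpos_of_nonneg_of_nonpos (by linarith) (not_lt.1 hc)
    linarith
  have h1z : 0 < 1 - z := by linarith
  have h1y : 0 < 1 - y := by linarith
  have hA0 : 0 ≤ A := mul_nonneg (mul_nonneg h1z.le (by linarith)) (by linarith)
  have hB0 : 0 ≤ B := mul_nonneg (mul_nonneg h1z.le (by linarith)) hg0.le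
  have hC0 : 0 ≤ C := mul_nonneg (mul_nonneg h1z.le hlam0) (by linarith)
  have hD0 : 0 ≤ D := mul_nonneg (mul_nonneg h1z.le hlam0) hg0.le
  have hCD : C + D = (1 - z) * lam := by rw [hC, hD]; ring
  have hkr : (k₁ : ℝ) ≤ k₂ := by exact_mod_cast hk
  have hk₁r : (1 : ℝ) ≤ k₁ := by exact_mod_cast hk₁
  have ha1 : (1 : ℝ) ≤ a := by exact_mod_cast ha
  have ht0 : 0 < t := by linarith
  have hPr : ((k₁ + a : ℕ) : ℝ) = (k₁ : ℝ) + a := by push_cast; ring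
  have hPng : ¬ (j + 1 ≤ k₁ + a) := by omega
  have hG : j + 1 ≤ k₂ + a := by omega
  have hKr : (0 : ℝ) < k₂ := by linarith
  have hmass : z + A + B + C + D = 1 := by rw [hA, hB, hC, hD]; ring
  have hyK : y * (k₂ : ℝ) ≤ S := (mul_le_mul_of_nonneg_left (by exact_mod_cast hk₂M) hy0.le).trans hta
  have hya : y * (a : ℝ) ≤ (a : ℝ) * g * (1 - z) := by
    have := mul_le_mul_of_nonneg_right hyg (Nat.cast_nonneg a)
    linarith [show (1 - z) * g * (a : ℝ) = (a : ℝ) * g * (1 - z) by ring]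
  have hSt : S ≤ t := by
    have : 0 ≤ (a : ℝ) * g * (1 - z) := mul_nonneg (mul_nonneg (Nat.cast_nonneg a) hg0.le) h1z.le
    rw [ht]; linarith
  have hyKt : y * (k₂ : ℝ) ≤ t := hyK.trans hSt
  have hyG : y * ((k₂ : ℝ) + a) ≤ t := by rw [mul_add, ht]; linarith
  have hyP : y * (((k₁ + a : ℕ) : ℝ)) ≤ t := by
    rw [hPr, mul_add, ht]
    have : y * (k₁ : ℝ) ≤ y * k₂ := mul_le_mul_of_nonneg_left hkr hy0.le
    linarith
  have huK : usage y t j k₁ k₂ = y / (1 - y) := usage_giant_eq y t j k₁ k₂ hKG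
  have huG : usage y t j k₁ (k₂ + a) = y / (1 - y) := usage_giant_eq y t j k₁ (k₂ + a) hG
  -- `K·mλ − S = −m k₁ (1−λ)`
  have hKS : (k₂ : ℝ) * ((1 - z) * lam) - S = -((1 - z) * k₁ * (1 - lam)) := by rw [← hmean]; ring
  have e0 : t * (1 - y) / y * C + t * (1 - y) / y * D = t * (1 - y) / y * (C + D) := by ring
  by_cases hw : w = 0
  · refine mixLawQ_decAtT_of_routing y z g S lam a j M k₁ k₂ xP 0 0 hy0 hy1 hz0 hz1 hg1 hyg ha hta hk hk₂M hlam0 hlam1 hmean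
      hk₁ hk₁j hk₁low (Or.inl hPmid) (Or.inr (by omega)) hG hxP0 le_rfl le_rfl
      (by rw [add_zero, add_zero]; rw [hw, add_zero] at hsplit; exact hsplit)
      (fun hx => Or.inr (hPcomp hx)) (fun h => absurd h (lt_irrefl _)) hcapP (by rw [mul_zero]; exact hC0)
      (by rw [mul_zero]; exact hD0) ?_
    rw [if_neg hPng, if_pos hKG, mul_zero, sub_zero, mul_zero, sub_zero]
    rw [hw, mul_zero, sub_zero] at hoff
    linarith [hoff, e0]
  · have hwpos : 0 < w := lt_of_le_of_ne hw0 (Ne.symm hw)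
    have hCDpos : 0 < C + D := by
      by_contra hc
      have h0 : C + D = 0 := le_antisymm (not_lt.1 hc) (add_nonneg hC0 hD0)
      have : y * w ≤ (1 - y) * (C + D) := hwcap
      rw [h0, mul_zero] at this
      linarith [mul_pos hy0 hwpos, mul_nonneg h1y.le (le_refl (0:ℝ))]
    obtain ⟨hcK, hcG⟩ := qh_pool_cap y w C D hy1 hC0 hD0 hCDpos hwcap
    have hxK0 : 0 ≤ w * C / (C + D) := div_nonneg (mul_nonneg hw0 hC0) hCDpos.le
    have hxG0 : 0 ≤ w * D / (C + D) := div_nonneg (mul_nonneg hw0 hD0) hCDpos.le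
    have hsum : w * C / (C + D) + w * D / (C + D) = w := by field_simp
    refine mixLawQ_decAtT_of_routing y z g S lam a j M k₁ k₂ xP (w * C / (C + D)) (w * D / (C + D)) hy0 hy1 hz0 hz1 hg1 hyg
      ha hta hk hk₂M hlam0 hlam1 hmean hk₁ hk₁j hk₁low (Or.inl hPmid) (Or.inr (by omega)) hG hxP0 hxK0 hxG0
      (by rw [add_assoc, hsum]; exact hsplit) (fun hx => Or.inr (hPcomp hx)) (fun _ => Or.inl hKG)
      hcapP (by rw [huK]; exact hcK) (by rw [huG]; exact hcG) ?_
    rw [if_neg hPng, if_pos hKG, huK, huG]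
    have hu1 : t * (1 - y) / y * (y / (1 - y)) = t := by
      have hy0' : y ≠ 0 := ne_of_gt hy0
      have h1y' : 1 - y ≠ 0 := ne_of_gt h1y
      field_simp
    have e : t * (1 - y) / y * (C - y / (1 - y) * (w * C / (C + D))) + t * (1 - y) / y * (D - y / (1 - y) * (w * D / (C + D)))
        = t * (1 - y) / y * (C + D) - (t * (1 - y) / y * (y / (1 - y))) * (w * C / (C + D) + w * D / (C + D)) := by ring
    rw [hu1, hsum] at e
    rw [add_assoc, e]
    linarith [hoff]

set_option maxHeartbeats 800000 in
/-- **cell QH, giant top, twin CLOSED to `k₁` (`2k₁ + a ≤ t`) ⟹ `Q` is DEC.** [this work] -/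
theorem mixLawQ_decAtT_qh_giantTop_closed (y z g S lam : ℝ) (a j M k₁ k₂ : ℕ)
    (hy0 : 0 < y) (hy1 : y < 1) (hz0 : 0 ≤ z) (hz1 : z < 1) (hg1 : g ≤ 1) (hyg : y ≤ (1 - z) * g) (ha : 1 ≤ a)
    (hta : y * (M : ℝ) ≤ S) (hk : k₁ ≤ k₂) (hk₂M : k₂ ≤ M) (hlam0 : 0 ≤ lam) (hlam1 : lam ≤ 1)
    (hmean : (1 - z) * ((k₁ : ℝ) + ((k₂ : ℝ) - k₁) * lam) = S)
    (hk₁ : 1 ≤ k₁) (hk₁j : k₁ ≤ j) (hk₁low : 2 * (k₁ : ℝ) < S + (a : ℝ) * g * (1 - z))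
    (hPj : k₁ + a ≤ j) (hPmid : S + (a : ℝ) * g * (1 - z) ≤ 2 * ((k₁ + a : ℕ) : ℝ))
    (hKG : j + 1 ≤ k₂)
    (hQH : 2 * S < S + (a : ℝ) * g * (1 - z)) (hcl : (k₁ : ℝ) + ((k₁ + a : ℕ) : ℝ) ≤ S + (a : ℝ) * g * (1 - z)) :
    DECAtT y (S + (a : ℝ) * g * (1 - z)) j (M + a)
      (fun p => z * (if p = 0 then (1 : ℝ) else 0) + (1 - z) * slice (fun q => TP[k₁, k₂, lam, q]) a g p) := by
  set t : ℝ := S + (a : ℝ) * g * (1 - z) with ht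
  set A : ℝ := (1 - z) * (1 - lam) * (1 - g) with hA
  set B : ℝ := (1 - z) * (1 - lam) * g with hB
  set C : ℝ := (1 - z) * lam * (1 - g) with hC
  set D : ℝ := (1 - z) * lam * g with hD
  have hg0 : 0 < g := by
    by_contra hc
    have : (1 - z) * g ≤ 0 := mul_nonpos_of_nonneg_of_nonpos (by linarith) (not_lt.1 hc)
    linarith
  have h1z : 0 < 1 - z := by linarith
  have h1y : 0 < 1 - y := by linarith
  have hA0 : 0 ≤ A := mul_nonneg (mul_nonneg h1z.le (by linarith)) (by linarith)
  have hB0 : 0 ≤ B := mul_nonneg (mul_nonneg h1z.le (by linarith)) hg0.le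
  have hC0 : 0 ≤ C := mul_nonneg (mul_nonneg h1z.le hlam0) (by linarith)
  have hD0 : 0 ≤ D := mul_nonneg (mul_nonneg h1z.le hlam0) hg0.le
  have hCD : C + D = (1 - z) * lam := by rw [hC, hD]; ring
  have hkr : (k₁ : ℝ) ≤ k₂ := by exact_mod_cast hk
  have hk₁r : (1 : ℝ) ≤ k₁ := by exact_mod_cast hk₁
  have ha1 : (1 : ℝ) ≤ a := by exact_mod_cast ha
  have ht0 : 0 < t := by linarith
  have hPr : ((k₁ + a : ℕ) : ℝ) = (k₁ : ℝ) + a := by push_cast; ring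
  have hPng : ¬ (j + 1 ≤ k₁ + a) := by omega
  have hG : j + 1 ≤ k₂ + a := by omega
  have hKr : (0 : ℝ) < k₂ := by linarith
  have hmass : z + A + B + C + D = 1 := by rw [hA, hB, hC, hD]; ring
  have hyK : y * (k₂ : ℝ) ≤ S := (mul_le_mul_of_nonneg_left (by exact_mod_cast hk₂M) hy0.le).trans hta
  have hya : y * (a : ℝ) ≤ (a : ℝ) * g * (1 - z) := by
    have := mul_le_mul_of_nonneg_right hyg (Nat.cast_nonneg a)
    linarith [show (1 - z) * g * (a : ℝ) = (a : ℝ) * g * (1 - z) by ring]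
  have hSt : S ≤ t := by
    have : 0 ≤ (a : ℝ) * g * (1 - z) := mul_nonneg (mul_nonneg (Nat.cast_nonneg a) hg0.le) h1z.le
    rw [ht]; linarith
  have hyKt : y * (k₂ : ℝ) ≤ t := hyK.trans hSt
  have hyG : y * ((k₂ : ℝ) + a) ≤ t := by rw [mul_add, ht]; linarith
  have hyP : y * (((k₁ + a : ℕ) : ℝ)) ≤ t := by
    rw [hPr, mul_add, ht]
    have : y * (k₁ : ℝ) ≤ y * k₂ := mul_le_mul_of_nonneg_left hkr hy0.le
    linarith
  have huK : usage y t j k₁ k₂ = y / (1 - y) := usage_giant_eq y t j k₁ k₂ hKG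
  have huG : usage y t j k₁ (k₂ + a) = y / (1 - y) := usage_giant_eq y t j k₁ (k₂ + a) hG
  -- `K·mλ − S = −m k₁ (1−λ)`
  have hKS : (k₂ : ℝ) * ((1 - z) * lam) - S = -((1 - z) * k₁ * (1 - lam)) := by rw [← hmean]; ring
  rw [hPr] at hcl
  -- `S ≥ 2k₁` and `g > 1/2`
  have hagz : (a : ℝ) * g * (1 - z) ≤ a := by
    have h5 : g * (1 - z) ≤ 1 := by
      calc g * (1 - z) ≤ g * 1 := mul_le_mul_of_nonneg_left (by linarith) hg0.le
        _ ≤ 1 := by linarith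
    have h6 := mul_le_mul_of_nonneg_left h5 (Nat.cast_nonneg a)
    linarith [h6, show (a : ℝ) * g * (1 - z) = (a : ℝ) * (g * (1 - z)) by ring]
  have hS2k : 2 * (k₁ : ℝ) ≤ S := by rw [ht] at hcl; linarith
  have hghalf : 1 < 2 * g := by
    have h1 : (a : ℝ) < 2 * ((a : ℝ) * g * (1 - z)) := by rw [ht] at hcl hQH; linarith
    have h2 : (a : ℝ) * g * (1 - z) ≤ a * g := mul_le_of_le_one_right (mul_nonneg (Nat.cast_nonneg a) hg0.le) (by linarith)
    by_contra hc
    have h3 : (a : ℝ) * (2 * g) ≤ (a : ℝ) * 1 := mul_le_mul_of_nonneg_left (by linarith) (Nat.cast_nonneg a)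
    linarith [h1, h2, h3, show (a : ℝ) * (2 * g) = 2 * ((a : ℝ) * g) by ring]
  -- `y(z + A) ≤ (1−y)(C+D)`: decreasing in `y`; at `y = S/K` it is `m(1−λ)(Sg − k₁)/K ≥ 0`
  have hEcrit : y * (z + A) ≤ (1 - y) * (C + D) := by
    have hzA : z + A = 1 - B - (C + D) := by linarith [hmass]
    have hend : S * (1 - B) ≤ (k₂ : ℝ) * (C + D) := by
      have e : (k₂ : ℝ) * (C + D) - S * (1 - B) = (1 - z) * (1 - lam) * (S * g - k₁) := by
        rw [hCD, hB]; linear_combination hKS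
      have hSg : (k₁ : ℝ) ≤ S * g := by
        have h4 : 2 * (k₁ : ℝ) * g ≤ S * g := mul_le_mul_of_nonneg_right hS2k hg0.le
        have h5 : 0 ≤ (k₁ : ℝ) * (2 * g - 1) := mul_nonneg (by linarith) (by linarith)
        linarith [h4, h5, show 2 * (k₁ : ℝ) * g = k₁ * (2 * g - 1) + k₁ by ring]
      have h6 := mul_nonneg (mul_nonneg h1z.le (sub_nonneg.2 hlam1)) (sub_nonneg.2 hSg)
      linarith [e, h6]
    have h1B : 0 ≤ 1 - B := by linarith [hmass, hA0, hC0, hD0, hz0]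
    have h2 : (k₂ : ℝ) * (y * (1 - B)) ≤ (k₂ : ℝ) * (C + D) := by
      have := mul_le_mul_of_nonneg_right hyK h1B
      linarith [this, hend, show (k₂ : ℝ) * (y * (1 - B)) = y * k₂ * (1 - B) by ring]
    have h3 : y * (1 - B) ≤ C + D := le_of_mul_le_mul_left h2 hKr
    rw [hzA]
    linarith [h3, show y * (1 - B - (C + D)) = y * (1 - B) - y * (C + D) by ring,
      show (1 - y) * (C + D) = (C + D) - y * (C + D) by ring]
  have hκ0 : 0 ≤ (if t < ((k₁ + a : ℕ) : ℝ) then ((k₁ + a : ℕ) : ℝ) - t else 0) := by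
    split_ifs with h
    · linarith
    · exact le_rfl
  have h1 : t * z + t * A ≤ t * (1 - y) / y * (C + D) := by
    have e : t * (1 - y) / y * (C + D) = t * ((1 - y) * (C + D) / y) := by ring
    rw [e, ← mul_add]
    refine mul_le_mul_of_nonneg_left ?_ ht0.le
    rw [le_div_iff₀ hy0]; linarith
  have hoff : t * z ≤ (if t < ((k₁ + a : ℕ) : ℝ) then ((k₁ + a : ℕ) : ℝ) - t else 0) * (B - usage y t j k₁ (k₁ + a) * 0)
      + t * (1 - y) / y * (C + D) - t * A := by
    rw [mul_zero, sub_zero]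
    have h2 := mul_nonneg hκ0 hB0
    linarith [h1, h2]
  exact mixLawQ_decAtT_qh_route y z g S lam a j M k₁ k₂ hy0 hy1 hz0 hz1 hg1 hyg ha hta hk hk₂M hlam0 hlam1 hmean hk₁ hk₁j hk₁low hPj hPmid hKG
    0 A le_rfl hA0 (by rw [hA]; ring) (fun h => absurd h (lt_irrefl _)) (by rw [mul_zero]; exact hB0)
    (by have := mul_nonneg hy0.le hz0; linarith [hEcrit, show y * (z + A) = y * z + y * A by ring]) hoff


end LawDec

end Quant

end Summit.CriticalPhenomena.PercolationContinuityZ3.Theorems
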